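import Literature.Analysis.FunctionSpaces.CheminLerner
import Literature.Analysis.FunctionSpaces.LittlewoodPaleyConvergenceProofs
import HarnessLib

/-!
# The free heat flow in the Chemin–Lerner spaces, in GKP's path space `𝓛^{1:∞}_{p,q}` and in
Kato's space

Proof file for `Literature/Analysis/FunctionSpaces/CheminLerner.lean` (the norms
`Literature.Analysis.FunctionSpaces.eCheminLernerNorm`, `Literature.Analysis.FunctionSpaces.eGKPPathNorm`, `Literature.Analysis.FunctionSpaces.eKatoNormDistrib`), assembling the blockwise heat
estimates of `LittlewoodPaleyHeatProofs.lean` (`‖e^{tΔ} Δ̇_j u‖_{L^p} ≲ e^{-ct4^j}‖Δ̇_j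
u‖_{L^p}`, its
`L̃¹_t` endpoint) and the `L^p` bound of `LittlewoodPaleyConvergenceProofs.lean`
(`‖e^{tΔ}u‖_{L^p} ≲ t^{-σ/2}‖u‖_{Ḃ^{-σ}_{p,∞}}`) into the statements about the **free evolution**
`Literature.heatPath U₀ = (t ↦ e^{tΔ} U₀)` that the local Cauchy theory of the Navier–Stokes equations in
critical Besov spaces starts from (Gallagher–Koch–Planchon 2016, p. 4 and App. B):

* `Literature.Analysis.FunctionSpaces.exists_eCheminLernerNorm_top_heatPath_le`: `‖e^{·Δ}U₀‖_{L̃^∞((0,∞); Ḃ^s_{p,q})} ≤ C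
‖U₀‖_{Ḃ^s_{p,q}}`;
* `Literature.Analysis.FunctionSpaces.exists_eCheminLernerNorm_one_heatPath_le`: `‖e^{·Δ}U₀‖_{L̃¹((0,∞); Ḃ^{s+2}_{p,q})} ≤ C
‖U₀‖_{Ḃ^s_{p,q}}`
  (maximal regularity);
* `Literature.Analysis.FunctionSpaces.exists_eGKPPathNorm_heatPath_le`: **`‖e^{·Δ}U₀‖_{𝓛^{1:∞}_{p,q}(0,T)} ≤ C
‖U₀‖_{Ḃ^{s_p}_{p,q}}`** for all `T`
  — the linear part of "`NS(u₀) ∈ X_T = 𝓛^{1:∞}_{p,q}(T)`" (GKP 2016, p. 4);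
* `Literature.Analysis.FunctionSpaces.exists_eKatoNormDistrib_heatPath_le`: **`sup_{0<t≤T} t^{σ/2}‖e^{tΔ}U₀‖_{L^p} ≤ C
‖U₀‖_{Ḃ^{-σ}_{p,∞}}`**
  for `σ > 0`, `U₀ ∈ 𝓢'_h` (GKP 2016, App. B: `‖e^{tΔ}v₀‖_{𝒦_p(0,∞)} ≤
c‖v₀‖_{Ḃ^{-1+3/p}_{p,∞}}`), with the
  `Literature.Analysis.FunctionSpaces.MemHomBesov` form `Literature.Analysis.FunctionSpaces.MemHomBesov.eKatoNormDistrib_heatPath_le`.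

All constants depend only on `p`, `d = dim E` (and `σ`); all statements are in `[0, ∞]`.

## References

* I. Gallagher, G. S. Koch, F. Planchon, *Blow-up of critical Besov norms at a potential
Navier–Stokes
  singularity*, Comm. Math. Phys. 343 (2016), §1.2 (p. 4: `NS(u₀) ∈ 𝓛^{1:∞}_{p,q}(T)`), (1.5),
App. B
  (the heat estimate and the Kato–Besov inequality). [cite: GKP2016, App. B]
* R. Danchin, *Fourier analysis methods for the compressible Navier–Stokes equations* (2018;
  arXiv:1507.02637), Remark 2.2 (`‖u‖_{L̃^{ρ₁}_t(Ḃ^{s+2/ρ₁}_{p,r})} ≲ ‖u₀‖_{Ḃ^s_{p,r}} + …`).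
[cite: Danchin2018FourierCNS, Rem. 2.2]
* T. Kato, *Strong `L^p`-solutions of the Navier–Stokes equation in `ℝ^m`*, Math. Z. 187 (1984)
  (the weighted-in-time class).
-/

noncomputable section

open MeasureTheory TemperedDistribution Set Filter Topology Function
open scoped SchwartzMap ENNReal NNReal Real

namespace Literature.Analysis.FunctionSpaces

/-! ## The free heat flow in the Chemin–Lerner, GKP and Kato norms -/

section FreeHeatFlow

variable {E F : Type*} [NormedAddCommGroup E] [InnerProductSpace ℝ E] [FiniteDimensional ℝ E]
  [MeasurableSpace E] [BorelSpace E] [NormedAddCommGroup F] [NormedSpace ℂ F]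

/-- The **free heat path** `t ↦ e^{tΔ} U₀` of a datum `U₀ ∈ 𝓢'(E, F)` (junk for `t < 0`, where
`TemperedDistribution.heatSemigroup` is junk). [folklore] -/
def heatPath (U₀ : 𝓢'(E, F)) (t : ℝ) : 𝓢'(E, F) := TemperedDistribution.heatSemigroup t U₀

/-- Unfolding `heatPath`. [folklore] -/
theorem heatPath_apply (U₀ : 𝓢'(E, F)) (t : ℝ) :
    heatPath U₀ t = TemperedDistribution.heatSemigroup t U₀ := rfl

variable [CompleteSpace F]

/-- **`e^{tΔ} U₀ ∈ L̃^∞(ℝ₊; Ḃ^s_{p,q})`** with `‖e^{·Δ} U₀‖_{L̃^∞((0,∞); Ḃ^s_{p,q})} ≤ C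
‖U₀‖_{Ḃ^s_{p,q}}`
(GKP 2016, App. B, (B.3) integrated in time with `ρ = ∞`; Danchin 2018, Rem. 2.2 with `ρ₁ = ∞`):
blockwise
`ess sup_t ‖Δ̇_j e^{tΔ}U₀‖_{L^p} ≤ C ‖Δ̇_j U₀‖_{L^p}`. [cite: GKP2016, App. B] -/
theorem exists_eCheminLernerNorm_top_heatPath_le (p : ℝ≥0∞) [Fact (1 ≤ p)] :
    ∃ C : ℝ≥0, ∀ (s : ℝ) (q : ℝ≥0∞) (U₀ : 𝓢'(E, F)),
      eCheminLernerNorm ∞ (Set.Ioi 0) s p q (heatPath U₀) ≤ C * eHomBesovNorm s p q U₀ := by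
  obtain ⟨C, -, hC⟩ := exists_eLpNormDistrib_heatSemigroup_lpBlock_le (E := E) (F := F) p
  refine ⟨C, fun s q U₀ => ?_⟩
  have hblock : ∀ j : ℤ, eBlockTimeNorm ∞ (Set.Ioi 0) p (heatPath U₀) j ≤ C * eLpNormDistrib p (lpBlock j U₀) := by
    intro j
    rw [eBlockTimeNorm_def, eLpNorm_exponent_top]
    refine eLpNormEssSup_le_of_ae_enorm_bound ?_
    refine (ae_restrict_iff' measurableSet_Ioi).2 (ae_of_all _ fun t (ht : 0 < t) => ?_)
    rw [enorm_eq_self, heatPath_apply, lpBlock_heatSemigroup_comm ht.le]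
    calc eLpNormDistrib p (TemperedDistribution.heatSemigroup t (lpBlock j U₀))
        ≤ C * ENNReal.ofReal (Real.exp (-(π ^ 2 / 8) * 2 ^ (2 * j) * t)) * eLpNormDistrib p (lpBlock j U₀) :=
          hC t ht.le j U₀
      _ ≤ C * 1 * eLpNormDistrib p (lpBlock j U₀) := by
          gcongr
          rw [ENNReal.ofReal_le_one, Real.exp_le_one_iff]
          have : (0 : ℝ) ≤ π ^ 2 / 8 * 2 ^ (2 * j) * t := by positivity
          linarith
      _ = C * eLpNormDistrib p (lpBlock j U₀) := by rw [mul_one]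
  rw [eCheminLernerNorm_def, eHomBesovNorm]
  refine eLpNorm_le_mul_eLpNorm_of_ae_le_mul' (ae_of_all _ fun j => ?_) q
  simp only [enorm_eq_self, lpBlockWeight]
  calc (2 : ℝ≥0∞) ^ ((j : ℝ) * s) * eBlockTimeNorm ∞ (Set.Ioi 0) p (heatPath U₀) j
      ≤ (2 : ℝ≥0∞) ^ ((j : ℝ) * s) * (C * eLpNormDistrib p (lpBlock j U₀)) := by gcongr; exact hblock j
    _ = C * ((2 : ℝ≥0∞) ^ ((j : ℝ) * s) * eLpNormDistrib p (lpBlock j U₀)) := by ring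

/-- **`e^{tΔ} U₀ ∈ L̃¹(ℝ₊; Ḃ^{s+2}_{p,q})`** with `‖e^{·Δ} U₀‖_{L̃¹((0,∞); Ḃ^{s+2}_{p,q})} ≤ C
‖U₀‖_{Ḃ^s_{p,q}}`
(the maximal-regularity endpoint: GKP 2016, App. B; Danchin 2018, Rem. 2.2 with `ρ₁ = 1`; BCD
(3.39)):
blockwise `∫₀^∞ ‖Δ̇_j e^{tΔ}U₀‖_{L^p} dt ≤ C 2^{-2j} ‖Δ̇_j U₀‖_{L^p}`. [cite: GKP2016, App. B] -/
theorem exists_eCheminLernerNorm_one_heatPath_le (p : ℝ≥0∞) [Fact (1 ≤ p)] :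
    ∃ C : ℝ≥0, ∀ (s : ℝ) (q : ℝ≥0∞) (U₀ : 𝓢'(E, F)),
      eCheminLernerNorm 1 (Set.Ioi 0) (s + 2) p q (heatPath U₀) ≤ C * eHomBesovNorm s p q U₀ := by
  obtain ⟨C, hC⟩ := exists_lintegral_eLpNormDistrib_lpBlock_heatSemigroup_le (E := E) (F := F) p
  refine ⟨C, fun s q U₀ => ?_⟩
  have hblock : ∀ j : ℤ, eBlockTimeNorm 1 (Set.Ioi 0) p (heatPath U₀) j ≤
      C * ENNReal.ofReal ((2 : ℝ) ^ (-(2 * j))) * eLpNormDistrib p (lpBlock j U₀) := by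
    intro j
    rw [eBlockTimeNorm_def, eLpNorm_one_eq_lintegral_enorm]
    simp only [enorm_eq_self, heatPath_apply]
    exact hC j U₀
  rw [eCheminLernerNorm_def, eHomBesovNorm]
  refine eLpNorm_le_mul_eLpNorm_of_ae_le_mul' (ae_of_all _ fun j => ?_) q
  simp only [enorm_eq_self, lpBlockWeight]
  have h2 : (2 : ℝ≥0∞) ^ ((j : ℝ) * (s + 2)) * ENNReal.ofReal ((2 : ℝ) ^ (-(2 * j))) =
      (2 : ℝ≥0∞) ^ ((j : ℝ) * s) := by
    rw [← Real.rpow_intCast, ← ENNReal.ofReal_rpow_of_pos two_pos, ENNReal.ofReal_ofNat,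
      two_rpow_mul_two_rpow]
    congr 1
    push_cast
    ring
  calc (2 : ℝ≥0∞) ^ ((j : ℝ) * (s + 2)) * eBlockTimeNorm 1 (Set.Ioi 0) p (heatPath U₀) j
      ≤ (2 : ℝ≥0∞) ^ ((j : ℝ) * (s + 2)) *
          (C * ENNReal.ofReal ((2 : ℝ) ^ (-(2 * j))) * eLpNormDistrib p (lpBlock j U₀)) := by
        gcongr; exact hblock j
    _ = C * (((2 : ℝ≥0∞) ^ ((j : ℝ) * (s + 2)) * ENNReal.ofReal ((2 : ℝ) ^ (-(2 * j)))) *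
          eLpNormDistrib p (lpBlock j U₀)) := by ring
    _ = C * ((2 : ℝ≥0∞) ^ ((j : ℝ) * s) * eLpNormDistrib p (lpBlock j U₀)) := by rw [h2]

/-- **The free evolution lies in GKP's path space `𝓛^{1:∞}_{p,q}(∞)`** (Gallagher–Koch–Planchon 2016,
App. A, (A.2): "`‖e^{tΔ} f₀‖_{𝓛^{r:∞}_{p,q}(T)} ≲ ‖f₀‖_{Ḃ^{s_p}_{p,q}}`", here `r = 1`; p. 4: the linear part
of `NS(u₀) ∈ X_T = 𝓛^{1:∞}_{p,q}(T)`): for `1 ≤ p ≤ ∞` there is `C` with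
`‖e^{·Δ} U₀‖_{𝓛^{1:∞}_{p,q}(0,T)} ≤ C ‖U₀‖_{Ḃ^{s_p}_{p,q}}` for every `T` and every `U₀ ∈ 𝓢'(E, F)`.
[cite: GKP2016, App. A, (A.2)] -/
theorem exists_eGKPPathNorm_heatPath_le (p : ℝ≥0∞) [Fact (1 ≤ p)] :
    ∃ C : ℝ≥0, ∀ (q : ℝ≥0∞) (T : ℝ) (U₀ : 𝓢'(E, F)),
      eGKPPathNorm 1 ∞ p q 0 T (heatPath U₀) ≤ C * eHomBesovNorm (criticalIndex E p) p q U₀ := by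
  obtain ⟨C₁, hC₁⟩ := exists_eCheminLernerNorm_one_heatPath_le (E := E) (F := F) p
  obtain ⟨C₂, hC₂⟩ := exists_eCheminLernerNorm_top_heatPath_le (E := E) (F := F) p
  refine ⟨max C₁ C₂, fun q T U₀ => ?_⟩
  rw [eGKPPathNorm_one_top]
  refine max_le ?_ ?_
  · calc eCheminLernerNorm 1 (Set.Ioo 0 T) (criticalIndex E p + 2) p q (heatPath U₀)
        ≤ eCheminLernerNorm 1 (Set.Ioi 0) (criticalIndex E p + 2) p q (heatPath U₀) :=
          eCheminLernerNorm_mono Set.Ioo_subset_Ioi_self _ _ _ _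
      _ ≤ C₁ * eHomBesovNorm (criticalIndex E p) p q U₀ := hC₁ _ q U₀
      _ ≤ ((max C₁ C₂ : ℝ≥0) : ℝ≥0∞) * eHomBesovNorm (criticalIndex E p) p q U₀ := by
          gcongr; exact le_max_left _ _
  · calc eCheminLernerNorm ∞ (Set.Ioo 0 T) (criticalIndex E p) p q (heatPath U₀)
        ≤ eCheminLernerNorm ∞ (Set.Ioi 0) (criticalIndex E p) p q (heatPath U₀) :=
          eCheminLernerNorm_mono Set.Ioo_subset_Ioi_self _ _ _ _
      _ ≤ C₂ * eHomBesovNorm (criticalIndex E p) p q U₀ := hC₂ _ q U₀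
      _ ≤ ((max C₁ C₂ : ℝ≥0) : ℝ≥0∞) * eHomBesovNorm (criticalIndex E p) p q U₀ := by
          gcongr; exact le_max_right _ _

/-- **The free evolution of `Ḃ^{-σ}_{p,∞}` data lies in Kato's space** (Gallagher–Koch–Planchon
2016,
App. B: `‖e^{tΔ} v₀‖_{𝒦_p(0,∞)} ≤ c ‖v₀‖_{Ḃ^{-1+3/p}_{p,∞}}`, the right inequality of the Kato–Besov
equivalence; Kato 1984): for `σ > 0` there is `C` with
`sup_{0<t≤T} t^{σ/2} ‖e^{tΔ} U₀‖_{L^p} ≤ C ‖U₀‖_{Ḃ^{-σ}_{p,∞}}` for every `T` and every `U₀ ∈ 𝓢'_h`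
(`Ṡ_j U₀ → 0` as `j → -∞`). [cite: GKP2016, App. B] -/
theorem exists_eKatoNormDistrib_heatPath_le (p : ℝ≥0∞) [Fact (1 ≤ p)] {σ : ℝ} (hσ : 0 < σ) :
    ∃ C : ℝ≥0, ∀ (T : ℝ) (U₀ : 𝓢'(E, F)),
      Tendsto (fun j : ℤ => lowFreqCutoff j U₀) atBot (𝓝 0) →
      eKatoNormDistrib (σ / 2) T p (heatPath U₀) ≤ C * eHomBesovNorm (-σ) p ∞ U₀ := by
  obtain ⟨C, hC⟩ := exists_eLpNormDistrib_heatSemigroup_le_rpow_mul_eHomBesovNorm (E := E) (F := F) p hσ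
  refine ⟨C, fun T U₀ h0 => eKatoNormDistrib_le_iff.2 fun t ht => ?_⟩
  rw [heatPath_apply]
  have htσ : ENNReal.ofReal (t ^ (σ / 2)) * ENNReal.ofReal (t ^ (-σ / 2)) = 1 := by
    rw [← ENNReal.ofReal_mul (Real.rpow_nonneg ht.1.le _), ← Real.rpow_add ht.1,
      show σ / 2 + -σ / 2 = 0 by ring, Real.rpow_zero, ENNReal.ofReal_one]
  calc ENNReal.ofReal (t ^ (σ / 2)) * eLpNormDistrib p (TemperedDistribution.heatSemigroup t U₀)
      ≤ ENNReal.ofReal (t ^ (σ / 2)) * (C * ENNReal.ofReal (t ^ (-σ / 2)) * eHomBesovNorm (-σ) p ∞ U₀) := by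
        gcongr; exact hC t ht.1 U₀ h0
    _ = C * (ENNReal.ofReal (t ^ (σ / 2)) * ENNReal.ofReal (t ^ (-σ / 2))) * eHomBesovNorm (-σ) p ∞ U₀ := by
        ring
    _ = C * eHomBesovNorm (-σ) p ∞ U₀ := by rw [htσ, mul_one]

/-- The Kato bound for data in the class `Ḃ^{-σ}_{p,q}` (`Literature.Analysis.FunctionSpaces.MemHomBesov` supplies the realisation
hypothesis; e.g. `σ = 1 - d/p` for critical Navier–Stokes data, GKP's `s_p = -σ`).
[cite: GKP2016, App. B] -/
theorem MemHomBesov.eKatoNormDistrib_heatPath_le {p q : ℝ≥0∞} [Fact (1 ≤ p)] {σ : ℝ} {C : ℝ≥0}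
    (hC : ∀ (T : ℝ) (U₀ : 𝓢'(E, F)), Tendsto (fun j : ℤ => lowFreqCutoff j U₀) atBot (𝓝 0) →
      eKatoNormDistrib (σ / 2) T p (heatPath U₀) ≤ C * eHomBesovNorm (-σ) p ∞ U₀)
    {U₀ : 𝓢'(E, F)} (h : MemHomBesov (-σ) p q U₀) (T : ℝ) :
    eKatoNormDistrib (σ / 2) T p (heatPath U₀) ≤ C * eHomBesovNorm (-σ) p ∞ U₀ :=
  hC T U₀ h.2

end FreeHeatFlow

end Literature.Analysis.FunctionSpaces
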